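import Mathlib
import Summits.NavierStokesRegularity.NavierStokesRegularity.Theorems.QuasipotentialCoercivityEnstrophyToL3CoercivityPressure
import Literature.Analysis.FluidPDE.ClassicalL2Stability
import Literature.Analysis.FluidPDE.LerayEnstrophyAPrioriForced
import Literature.Analysis.FluidPDE.EnergyUniqueness
import Literature.Analysis.FluidPDE.TaoEnergyLocalisation
import Literature.MathematicalPhysics.KineticTheory.DiPernaLionsExpDuhamel
import HarnessLib

/-!
# The energy of a forced classical path from rest is controlled by its action
  (tools for item stmt-NavierStokesRegularity-1445, `QuasipotentialCoercivity.EnstrophyToL3Coercivity`)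

For a classical forced path `(w, q, g)` on `ℝ³ × [0, T₀]` (`IsClassicalNSSolutionOn (Icc 0 T₀) ν g w q`,
`ν ≥ 0`) with `w` uniformly Schwartz (`HasUniformRapidDecayOn`) and `w(0) = 0`:

  `∫⁻ ‖w(t)‖ₑ² ≤ 4 T₀ · ∫₀^{T₀} ∫⁻ ‖g‖ₑ²`  for every `t ∈ [0, T₀]`  (`lintegral_sq_le_action`).

The pressure `q` is UNCONTROLLED (only smooth): the energy production at a fixed time
(`ofReal_production_le₃`) is `∫ 2⟪w, ∂ₜw⟫ = 2(ν∫⟪w, Δw⟫ − ∫⟪(w·∇)w, w⟫ − ∫⟪w, ∇q⟫ + ∫⟪w, g⟫)`, where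
the dissipation is `≤ 0` (`integral_inner_laplacian_self_nonpos`), the transport term vanishes
(`integral_inner_fderiv_apply_self_eq_zero`) and the pressure pairing vanishes by
`EnstrophyToL3.integral_inner_gradient_eq_zero₃` (`w = curl (biotSavart w)`, `L¹` divergence theorem;
licit because `∇q = g − ∂ₜw − (w·∇)w + νΔw ∈ L² + 𝒮` at every time with `g ∈ L²`); then
`2‖w‖‖g‖ ≤ ‖w‖²/(2T₀) + 2T₀‖g‖²`, the `L²` balance `IsSmoothSpaceTimeOn.l2_balance` at the time where
`∫‖w‖²` is maximal, and absorption.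

HONEST FRAMING: an elementary a-priori bound about forced classical paths; nothing here bears on
Navier–Stokes regularity.

## References
* A. J. Majda, A. L. Bertozzi, *Vorticity and Incompressible Flow*, CUP (2002), §1.7 Prop. 1.13.
* C. R. Doering, J. D. Gibbon, *Applied Analysis of the Navier–Stokes Equations*, CUP (1995),
  eqs. (1.4.16)–(1.4.19).
-/

noncomputable section

set_option linter.dupNamespace false

namespace Summit.NavierStokesRegularity.NavierStokesRegularity.Theorems

open Set MeasureTheory Filter Topology Function InnerProductSpace
open scoped ENNReal NNReal RealInnerProductSpace ContDiff Laplacian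
open Literature.Analysis.FluidPDE

namespace EnstrophyToL3

/-! ### The energy production of a forced path at a fixed time -/

/-- The force of a classical path is continuous: `f = V + (v·∇)v − νΔv + ∇P`. [folklore] -/
theorem continuous_force₃ {ν : ℝ} {v V f : EuclideanSpace ℝ (Fin 3) → EuclideanSpace ℝ (Fin 3)}
    {P : EuclideanSpace ℝ (Fin 3) → ℝ}
    (hv : ContDiff ℝ 2 v) (cV : Continuous V) (hP : ContDiff ℝ 2 P)
    (heq : ∀ x, V x + convect v v x = ν • (Δ v) x - gradient P x + f x) : Continuous f := by
  have cDv : Continuous (fderiv ℝ v) := hv.continuous_fderiv (by norm_num)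
  have hc : Continuous fun x => V x + convect v v x - ν • (Δ v) x + gradient P x :=
    ((cV.add (cDv.clm_apply hv.continuous)).sub ((continuous_laplacian hv).const_smul ν)).add
      (continuous_gradient_of_contDiff (hP.of_le (by norm_num)))
  refine hc.congr fun x => ?_
  rw [heq x]; abel

/-- Product of two decaying bounds (`ℝ³`): `a b ≤ A B (1 + ‖x‖)^{-r}`. [folklore] -/
theorem mul_le_decay₃ {r : ℝ} (hr : 0 ≤ r) {a b A B : ℝ} (x : EuclideanSpace ℝ (Fin 3))
    (ha : 0 ≤ a) (hb : 0 ≤ b)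
    (haA : a ≤ A * (1 + ‖x‖) ^ (-r)) (hbB : b ≤ B * (1 + ‖x‖) ^ (-r)) (hA : 0 ≤ A) :
    a * b ≤ A * B * (1 + ‖x‖) ^ (-r) := by
  have hle1 : (1 + ‖x‖) ^ (-r) ≤ (1 : ℝ) := rpow_neg_le_one x hr
  have hB : 0 ≤ B * (1 + ‖x‖) ^ (-r) := hb.trans hbB
  calc a * b ≤ (A * (1 + ‖x‖) ^ (-r)) * (B * (1 + ‖x‖) ^ (-r)) := mul_le_mul haA hbB hb (ha.trans haA)
    _ ≤ (A * 1) * (B * (1 + ‖x‖) ^ (-r)) := by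
        refine mul_le_mul_of_nonneg_right ?_ hB
        exact mul_le_mul_of_nonneg_left hle1 hA
    _ = A * B * (1 + ‖x‖) ^ (-r) := by ring

/-- **Energy production at a fixed time, with uncontrolled pressure.** Let `v ∈ C²(ℝ³; ℝ³)` be
divergence free with `‖v‖, ‖Dv‖, ‖D²v‖ ≤ C (1 + ‖x‖)^{-5}`, `V` continuous with `‖V‖ ≤ C (1 + ‖x‖)^{-5}`,
`P ∈ C²`, and `V + (v·∇)v = νΔv − ∇P + f` (`ν ≥ 0`). If `∫ ‖v‖² ≤ M₂` then, for every `T₀ > 0`,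
`ofReal (∫ 2⟪v, V⟫) ≤ ofReal (M₂ / (2T₀)) + ofReal (2T₀) ∫⁻ ‖f‖ₑ²`: indeed
`∫⟪v, V⟫ = ν∫⟪v,Δv⟫ − ∫⟪(v·∇)v, v⟫ − ∫⟪v, ∇P⟫ + ∫⟪v, f⟫ ≤ ∫⟪v, f⟫` (dissipation `≤ 0`, transport
`= 0`, and the pressure pairing `= 0` by `integral_inner_gradient_eq_zero₃` since
`∇P = f − (V + (v·∇)v − νΔv) ∈ L² + 𝒮`), then `2‖v‖‖f‖ ≤ ‖v‖²/(2T₀) + 2T₀‖f‖²`. [folklore] -/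
theorem ofReal_production_le₃ {ν T₀ : ℝ} (hν : 0 ≤ ν) (hT₀ : 0 < T₀)
    {v V f : EuclideanSpace ℝ (Fin 3) → EuclideanSpace ℝ (Fin 3)} {P : EuclideanSpace ℝ (Fin 3) → ℝ}
    (hv : ContDiff ℝ 2 v) (cV : Continuous V) (hP : ContDiff ℝ 2 P)
    (hdiv : VectorCalculus.IsDivFree v)
    (heq : ∀ x, V x + convect v v x = ν • (Δ v) x - gradient P x + f x)
    {C : ℝ} (hC : 0 ≤ C)
    (h0 : ∀ x, ‖v x‖ ≤ C * (1 + ‖x‖) ^ (-(5 : ℝ)))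
    (h1 : ∀ x, ‖fderiv ℝ v x‖ ≤ C * (1 + ‖x‖) ^ (-(5 : ℝ)))
    (h2 : ∀ x, ‖fderiv ℝ (fderiv ℝ v) x‖ ≤ C * (1 + ‖x‖) ^ (-(5 : ℝ)))
    (hV0 : ∀ x, ‖V x‖ ≤ C * (1 + ‖x‖) ^ (-(5 : ℝ)))
    {M₂ : ℝ} (hM : ∫ x, ‖v x‖ ^ 2 ≤ M₂) :
    ENNReal.ofReal (∫ x, 2 * ⟪v x, V x⟫) ≤
      ENNReal.ofReal (M₂ / (2 * T₀)) + ENNReal.ofReal (2 * T₀) * ∫⁻ x, ‖f x‖ₑ ^ 2 := by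
  by_cases hf : ∫⁻ x, ‖f x‖ₑ ^ 2 < ⊤
  swap
  · rw [not_lt, top_le_iff] at hf
    rw [hf, ENNReal.mul_top (by simp [hT₀])]
    simp
  have hv1 : ContDiff ℝ 1 v := hv.of_le (by norm_num)
  have cv : Continuous v := hv.continuous
  have cDv : Continuous (fderiv ℝ v) := hv.continuous_fderiv (by norm_num)
  have cΔ : Continuous (Δ v) := continuous_laplacian hv
  have cc : Continuous (convect v v) := cDv.clm_apply cv
  have cgP : Continuous (gradient P) := continuous_gradient_of_contDiff (hP.of_le (by norm_num))
  have cf : Continuous f := continuous_force₃ hv cV hP heq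
  have hf2 : Integrable (fun x => ‖f x‖ ^ 2) volume := integrable_sq_of_lintegral_enorm_sq_lt_top cf hf
  have hr5 : (0 : ℝ) ≤ 5 := by norm_num
  -- pointwise bounds
  have bΔ : ∀ x, ‖(Δ v) x‖ ≤ 3 * C * (1 + ‖x‖) ^ (-(5 : ℝ)) := fun x => by
    calc ‖(Δ v) x‖ ≤ Module.finrank ℝ (EuclideanSpace ℝ (Fin 3)) * ‖fderiv ℝ (fderiv ℝ v) x‖ :=
          norm_laplacian_le v x
      _ = 3 * ‖fderiv ℝ (fderiv ℝ v) x‖ := by simp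
      _ ≤ 3 * (C * (1 + ‖x‖) ^ (-(5 : ℝ))) := by gcongr; exact h2 x
      _ = 3 * C * (1 + ‖x‖) ^ (-(5 : ℝ)) := by ring
  have bc : ∀ x, ‖convect v v x‖ ≤ C * C * (1 + ‖x‖) ^ (-(5 : ℝ)) := fun x =>
    ((fderiv ℝ v x).le_opNorm _).trans
      (mul_le_decay₃ hr5 x (norm_nonneg _) (norm_nonneg _) (h1 x) (h0 x) hC)
  -- integrability of the pairings of `v`
  have ivV : Integrable (fun x => ⟪v x, V x⟫) volume :=
    integrable_of_le_decay₃ (r := 5) (cv.inner cV) (by norm_num) fun x => (norm_inner_le_norm _ _).trans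
      (mul_le_decay₃ hr5 x (norm_nonneg _) (norm_nonneg _) (h0 x) (hV0 x) hC)
  have ivv : Integrable (fun x => ‖v x‖ ^ 2) volume :=
    integrable_of_le_decay₃ (r := 5) ((cv.norm).pow 2) (by norm_num) fun x => by
      rw [norm_pow, norm_norm, sq]
      exact mul_le_decay₃ hr5 x (norm_nonneg _) (norm_nonneg _) (h0 x) (h0 x) hC
  have ivf : Integrable (fun x => ⟪v x, f x⟫) volume := by
    have hb : Integrable (fun x => (‖v x‖ ^ 2 + ‖f x‖ ^ 2) / 2) volume := by
      exact (ivv.add hf2).div_const 2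
    refine hb.mono' (cv.inner cf).aestronglyMeasurable (Eventually.of_forall fun x => ?_)
    have e1 : ‖⟪v x, f x⟫‖ ≤ ‖v x‖ * ‖f x‖ := norm_inner_le_norm _ _
    have e2 : ‖v x‖ * ‖f x‖ ≤ (‖v x‖ ^ 2 + ‖f x‖ ^ 2) / 2 := by
      nlinarith [sq_nonneg (‖v x‖ - ‖f x‖)]
    exact e1.trans e2
  -- the pressure gradient and its pairing
  set h : EuclideanSpace ℝ (Fin 3) → EuclideanSpace ℝ (Fin 3) :=
    fun x => V x + convect v v x - ν • (Δ v) x with hhdef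
  have hsplit : ∀ x, gradient P x = f x - h x := fun x => by
    rw [hhdef]; simp only
    rw [← sub_eq_zero]
    have := heq x
    rw [← sub_eq_zero] at this
    rw [← this]; abel
  have ch : Continuous h := (cV.add cc).sub (cΔ.const_smul ν)
  have hh : ∀ x, ‖h x‖ ≤ (C + C * C + ν * (3 * C)) * (1 + ‖x‖) ^ (-(4 : ℝ)) := fun x => by
    have hw54 : (1 + ‖x‖) ^ (-(5 : ℝ)) ≤ (1 + ‖x‖) ^ (-(4 : ℝ)) :=
      rpow_neg_le_rpow_neg_of_le x (by norm_num)
    have hK0 : 0 ≤ C + C * C + ν * (3 * C) := by positivity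
    have t1 : ‖h x‖ ≤ ‖V x‖ + ‖convect v v x‖ + ‖ν • (Δ v) x‖ :=
      (norm_sub_le _ _).trans (by gcongr; exact norm_add_le _ _)
    have t2 : ‖ν • (Δ v) x‖ ≤ ν * (3 * C * (1 + ‖x‖) ^ (-(5 : ℝ))) := by
      rw [norm_smul, Real.norm_eq_abs, abs_of_nonneg hν]
      exact mul_le_mul_of_nonneg_left (bΔ x) hν
    calc ‖h x‖ ≤ C * (1 + ‖x‖) ^ (-(5 : ℝ)) + C * C * (1 + ‖x‖) ^ (-(5 : ℝ)) +
          ν * (3 * C * (1 + ‖x‖) ^ (-(5 : ℝ))) := by linarith [hV0 x, bc x]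
      _ = (C + C * C + ν * (3 * C)) * (1 + ‖x‖) ^ (-(5 : ℝ)) := by ring
      _ ≤ (C + C * C + ν * (3 * C)) * (1 + ‖x‖) ^ (-(4 : ℝ)) :=
          mul_le_mul_of_nonneg_left hw54 hK0
  have hpt : ∀ x, ⟪v x, V x⟫ =
      ν * ⟪v x, (Δ v) x⟫ - ⟪v x, convect v v x⟫ - ⟪v x, gradient P x⟫ + ⟪v x, f x⟫ := fun x => by
    have hVx : V x = ν • (Δ v) x - convect v v x - gradient P x + f x := by
      rw [eq_sub_of_add_eq (heq x)]; abel
    rw [hVx]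
    simp only [inner_add_right, inner_sub_right, real_inner_smul_right]
  have iΔv' : Integrable (fun x => ⟪v x, (Δ v) x⟫) volume :=
    integrable_of_le_decay₃ (r := 5) (cv.inner cΔ) (by norm_num) fun x => (norm_inner_le_norm _ _).trans
      (mul_le_decay₃ hr5 x (norm_nonneg _) (norm_nonneg _) (h0 x) (bΔ x) hC)
  have icv' : Integrable (fun x => ⟪v x, convect v v x⟫) volume :=
    integrable_of_le_decay₃ (r := 5) (cv.inner cc) (by norm_num) fun x => (norm_inner_le_norm _ _).trans
      (mul_le_decay₃ hr5 x (norm_nonneg _) (norm_nonneg _) (h0 x) (bc x) hC)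
  have ivP : Integrable (fun x => ⟪v x, gradient P x⟫) volume := by
    have : (fun x => ⟪v x, gradient P x⟫) =
        fun x => ν * ⟪v x, (Δ v) x⟫ - ⟪v x, convect v v x⟫ + ⟪v x, f x⟫ - ⟪v x, V x⟫ := by
      funext x; rw [hpt x]; ring
    rw [this]
    exact (((iΔv'.const_mul ν).sub icv').add ivf).sub ivV
  have hPz : ∫ x, ⟪v x, gradient P x⟫ = 0 :=
    integral_inner_gradient_eq_zero₃ hv1 hdiv hC h0 h1 hP hsplit cf hf ch hh ivP
  have hTz : ∫ x, ⟪v x, convect v v x⟫ = 0 := by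
    have hr : (Module.finrank ℝ (EuclideanSpace ℝ (Fin 3)) : ℝ) + 1 < 5 := by simp; norm_num
    have h := integral_inner_fderiv_apply_self_eq_zero (v := v) (w := v) hv1 hv1 hdiv hC hr h0 h1 h0 h1
    rw [← h]
    exact integral_congr_ae (Eventually.of_forall fun x => real_inner_comm (convect v v x) (v x))
  have hDz : ∫ x, ⟪v x, (Δ v) x⟫ ≤ 0 := by
    have hr : (Module.finrank ℝ (EuclideanSpace ℝ (Fin 3)) : ℝ) < 5 := by simp; norm_num
    have h := integral_inner_laplacian_self_nonpos hv hC hr h0 h1 h2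
    refine le_of_eq_of_le ?_ h
    exact integral_congr_ae (Eventually.of_forall fun x => real_inner_comm ((Δ v) x) (v x))
  -- the production
  have hprod : ∫ x, 2 * ⟪v x, V x⟫ ≤ M₂ / (2 * T₀) + 2 * T₀ * ∫ x, ‖f x‖ ^ 2 := by
    have iA : Integrable (fun x => ν * ⟪v x, (Δ v) x⟫) volume := iΔv'.const_mul ν
    have iB : Integrable (fun x => ν * ⟪v x, (Δ v) x⟫ - ⟪v x, convect v v x⟫) volume := iA.sub icv'
    have iC : Integrable (fun x => ν * ⟪v x, (Δ v) x⟫ - ⟪v x, convect v v x⟫ -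
        ⟪v x, gradient P x⟫) volume := iB.sub ivP
    have hI : ∫ x, ⟪v x, V x⟫ = ν * (∫ x, ⟪v x, (Δ v) x⟫) + ∫ x, ⟪v x, f x⟫ := by
      rw [integral_congr_ae (Eventually.of_forall hpt), integral_add iC ivf, integral_sub iB ivP,
        integral_sub iA icv', integral_const_mul, hPz, hTz]
      ring
    have hvf : ∫ x, 2 * ⟪v x, f x⟫ ≤ ∫ x, (‖v x‖ ^ 2 / (2 * T₀) + 2 * T₀ * ‖f x‖ ^ 2) := by
      refine integral_mono (ivf.const_mul 2) ((ivv.div_const (2 * T₀)).add (hf2.const_mul _))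
        fun x => ?_
      have e1 : ⟪v x, f x⟫ ≤ ‖v x‖ * ‖f x‖ := real_inner_le_norm _ _
      have e2 : ‖v x‖ ^ 2 / (2 * T₀) + 2 * T₀ * ‖f x‖ ^ 2 - 2 * (‖v x‖ * ‖f x‖) =
          (‖v x‖ - 2 * T₀ * ‖f x‖) ^ 2 / (2 * T₀) := by
        field_simp
        ring
      have e3 : 0 ≤ (‖v x‖ - 2 * T₀ * ‖f x‖) ^ 2 / (2 * T₀) := by positivity
      simp only
      linarith
    rw [integral_const_mul, hI]
    rw [integral_add (ivv.div_const (2 * T₀)) (hf2.const_mul _), integral_const_mul,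
      integral_div] at hvf
    rw [integral_const_mul] at hvf
    have hνD : ν * ∫ x, ⟪v x, (Δ v) x⟫ ≤ 0 := mul_nonpos_of_nonneg_of_nonpos hν hDz
    have hM' : (∫ x, ‖v x‖ ^ 2) / (2 * T₀) ≤ M₂ / (2 * T₀) :=
      div_le_div_of_nonneg_right hM (by positivity)
    linarith
  -- in `[0, ∞]`
  calc ENNReal.ofReal (∫ x, 2 * ⟪v x, V x⟫)
      ≤ ENNReal.ofReal (M₂ / (2 * T₀) + 2 * T₀ * ∫ x, ‖f x‖ ^ 2) := ENNReal.ofReal_le_ofReal hprod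
    _ ≤ ENNReal.ofReal (M₂ / (2 * T₀)) + ENNReal.ofReal (2 * T₀ * ∫ x, ‖f x‖ ^ 2) :=
        ENNReal.ofReal_add_le
    _ = ENNReal.ofReal (M₂ / (2 * T₀)) + ENNReal.ofReal (2 * T₀) * ∫⁻ x, ‖f x‖ₑ ^ 2 := by
        rw [ENNReal.ofReal_mul (by positivity), ofReal_integral_norm_sq_eq_lintegral hf2]

/-! ### The energy of a forced path from rest is controlled by the action -/

/-- **Energy of a forced path from rest ≤ 4 T₀ × action.** For a classical forced path
`(w, q, g)` on `ℝ³ × [0, T₀]` (`ν ≥ 0`) with `w` uniformly Schwartz and `w(0) = 0`: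
`∫⁻ ‖w(t)‖ₑ² ≤ 4T₀ ∫₀^{T₀} ∫⁻ ‖g‖ₑ²` for every `t ∈ [0, T₀]`. Proof: with `E(t) = ∫‖w(t)‖²` and
`M₂ = max E` (attained at `t*`), the `L²` balance `E(t*) = ∫₀^{t*} ∫ 2⟪w, ∂ₜw⟫`
(`IsSmoothSpaceTimeOn.l2_balance`) and the production bound at every time give
`M₂ ≤ M₂/2 + 2T₀·action`. The pressure is uncontrolled (`integral_inner_gradient_eq_zero₃`). [folklore] -/
theorem lintegral_sq_le_action {ν T₀ : ℝ} (hν : 0 ≤ ν) (hT₀ : 0 < T₀)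
    {w g : ℝ → EuclideanSpace ℝ (Fin 3) → EuclideanSpace ℝ (Fin 3)}
    {q : ℝ → EuclideanSpace ℝ (Fin 3) → ℝ}
    (hcl : IsClassicalNSSolutionOn (Icc 0 T₀) ν g w q) (hdec : HasUniformRapidDecayOn (Icc 0 T₀) w)
    (hw0 : w 0 = 0) :
    ∀ t ∈ Icc (0 : ℝ) T₀, ∫⁻ x, ‖w t x‖ₑ ^ 2 ≤
      ENNReal.ofReal (4 * T₀) * ∫⁻ s in Icc 0 T₀, eEnergy (g s) := by
  set A : ℝ≥0∞ := ∫⁻ s in Icc 0 T₀, eEnergy (g s) with hAdef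
  have hU : UniqueDiffOn ℝ (Icc (0 : ℝ) T₀) := uniqueDiffOn_Icc hT₀
  have hsm : IsSmoothSpaceTimeOn (Icc 0 T₀) w := hcl.smooth_velocity
  have hsmq : IsSmoothSpaceTimeOn (Icc 0 T₀) q := hcl.smooth_pressure
  set W : ℝ → EuclideanSpace ℝ (Fin 3) → EuclideanSpace ℝ (Fin 3) :=
    timeDerivWithin (Icc 0 T₀) w with hWdef
  have hWsm : IsSmoothSpaceTimeOn (Icc 0 T₀) W := hsm.timeDerivWithin hU
  have hWdec : HasUniformRapidDecayOn (Icc 0 T₀) W := hdec.timeDerivWithin hsm hU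
  -- the `L²` balance
  obtain ⟨C₀, hC₀⟩ := hdec.exists_lintegral_iteratedFDeriv_slice_sq_le_Icc (μ := volume) hsm hT₀ 0
  obtain ⟨C₁, hC₁⟩ := hWdec.exists_lintegral_iteratedFDeriv_slice_sq_le_Icc (μ := volume) hWsm hT₀ 0
  have hC₀' : ∀ t ∈ Icc (0 : ℝ) T₀, ∫⁻ x, ‖w t x‖ₑ ^ 2 ≤ C₀ := fun t ht => by
    calc ∫⁻ x, ‖w t x‖ₑ ^ 2 = ∫⁻ x, ‖iteratedFDeriv ℝ 0 (w t) x‖ₑ ^ 2 :=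
          lintegral_congr fun x => by
            rw [← ofReal_norm (w t x), ← ofReal_norm (iteratedFDeriv ℝ 0 (w t) x),
              norm_iteratedFDeriv_zero]
      _ ≤ C₀ := hC₀ t ht
  have hC₁' : ∀ t ∈ Icc (0 : ℝ) T₀, ∫⁻ x, ‖W t x‖ₑ ^ 2 ≤ C₁ := fun t ht => by
    calc ∫⁻ x, ‖W t x‖ₑ ^ 2 = ∫⁻ x, ‖iteratedFDeriv ℝ 0 (W t) x‖ₑ ^ 2 :=
          lintegral_congr fun x => by
            rw [← ofReal_norm (W t x), ← ofReal_norm (iteratedFDeriv ℝ 0 (W t) x),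
              norm_iteratedFDeriv_zero]
      _ ≤ C₁ := hC₁ t ht
  obtain ⟨-, hcont, hbal⟩ := hsm.l2_balance hT₀ hC₀' hC₁'
  set E : ℝ → ℝ := fun t => ∫ x, ‖w t x‖ ^ 2 with hEdef
  -- the maximum of `E` on `[0, T₀]`
  obtain ⟨ts, hts, hmax⟩ := isCompact_Icc.exists_isMaxOn (nonempty_Icc.2 hT₀.le) hcont
  set M₂ : ℝ := E ts with hM₂
  have hEle : ∀ t ∈ Icc (0 : ℝ) T₀, E t ≤ M₂ := fun t ht => hmax ht
  have hE0 : E 0 = 0 := by simp [hEdef, hw0]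
  have hM₂0 : 0 ≤ M₂ := hE0 ▸ hEle 0 ⟨le_rfl, hT₀.le⟩
  -- uniform Schwartz constants (weight `(1 + ‖x‖)^{-5}`)
  obtain ⟨K₀, hK₀0, hK₀⟩ := hdec.exists_uniform_slice_bound hsm hT₀ 0 5
  obtain ⟨K₁, -, hK₁⟩ := hdec.exists_uniform_slice_bound hsm hT₀ 1 5
  obtain ⟨K₂, -, hK₂⟩ := hdec.exists_uniform_slice_bound hsm hT₀ 2 5
  obtain ⟨L₀, -, hL₀⟩ := hWdec.exists_uniform_slice_bound hWsm hT₀ 0 5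
  set C : ℝ := max (max K₀ K₁) (max K₂ L₀) with hCdef
  have hCK0 : 0 ≤ C := hK₀0.trans ((le_max_left _ _).trans (le_max_left _ _))
  have conv : ∀ {a K : ℝ} (x : EuclideanSpace ℝ (Fin 3)), (1 + ‖x‖) ^ (5 : ℕ) * a ≤ K → K ≤ C →
      a ≤ C * (1 + ‖x‖) ^ (-(5 : ℝ)) := by
    intro a K x h hK
    have h' := le_mul_rpow_neg_of_pow_mul_le h
    have h'' : a ≤ C * (1 + ‖x‖) ^ (-((5 : ℕ) : ℝ)) :=
      h'.trans (mul_le_mul_of_nonneg_right hK (Real.rpow_nonneg (by positivity) _))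
    simpa using h''
  -- production bound at every time
  have hslice : ∀ t ∈ Icc (0 : ℝ) T₀, ENNReal.ofReal (∫ x, 2 * ⟪w t x, W t x⟫) ≤
      ENNReal.ofReal (M₂ / (2 * T₀)) + ENNReal.ofReal (2 * T₀) * eEnergy (g t) := by
    intro t ht
    have hv : ContDiff ℝ 2 (w t) := (hsm.contDiff_slice ht).of_le (by norm_cast)
    have cV : Continuous (W t) := (hWsm.contDiff_slice ht).continuous
    have hP : ContDiff ℝ 2 (q t) := (hsmq.contDiff_slice ht).of_le (by norm_cast)
    have h0 : ∀ x, ‖w t x‖ ≤ C * (1 + ‖x‖) ^ (-(5 : ℝ)) := fun x =>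
      conv x (by simpa [norm_iteratedFDeriv_zero] using hK₀ t ht x) (by simp [hCdef])
    have h1 : ∀ x, ‖fderiv ℝ (w t) x‖ ≤ C * (1 + ‖x‖) ^ (-(5 : ℝ)) := fun x =>
      conv x (by simpa [norm_iteratedFDeriv_one] using hK₁ t ht x) (by simp [hCdef])
    have h2 : ∀ x, ‖fderiv ℝ (fderiv ℝ (w t)) x‖ ≤ C * (1 + ‖x‖) ^ (-(5 : ℝ)) := fun x => by
      refine conv x ?_ (show K₂ ≤ C by simp [hCdef])
      have := hK₂ t ht x
      rwa [← norm_iteratedFDeriv_fderiv, norm_iteratedFDeriv_one] at this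
    have hV0 : ∀ x, ‖W t x‖ ≤ C * (1 + ‖x‖) ^ (-(5 : ℝ)) := fun x =>
      conv x (by simpa [norm_iteratedFDeriv_zero] using hL₀ t ht x) (by simp [hCdef])
    exact ofReal_production_le₃ hν hT₀ hv cV hP (hcl.divFree t ht) (hcl.momentum t ht) hCK0
      h0 h1 h2 hV0 (hEle t ht)
  -- `M₂ ≤ M₂ / 2 + 2 T₀ A`
  have hkey : ENNReal.ofReal M₂ ≤ ENNReal.ofReal (M₂ / 2) + ENNReal.ofReal (2 * T₀) * A := by
    rcases eq_or_lt_of_le hts.1 with h0 | hpos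
    · rw [hM₂, ← h0, hE0]; simp
    · have hb : E ts = E 0 + ∫ t in (0 : ℝ)..ts, ∫ x, 2 * ⟪w t x, W t x⟫ := hbal ts ⟨hpos, hts.2⟩
      rw [hE0, zero_add, intervalIntegral.integral_of_le hpos.le, integral_Ioc_eq_integral_Ioo] at hb
      have hvol : volume (Ioo (0 : ℝ) ts) = ENNReal.ofReal ts := by rw [Real.volume_Ioo, sub_zero]
      calc ENNReal.ofReal M₂ = ENNReal.ofReal (∫ t in Ioo 0 ts, ∫ x, 2 * ⟪w t x, W t x⟫) := by
            rw [hM₂]; exact congrArg _ hb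
        _ ≤ ∫⁻ t in Ioo 0 ts, ENNReal.ofReal (∫ x, 2 * ⟪w t x, W t x⟫) :=
            Literature.MathematicalPhysics.KineticTheory.ofReal_integral_le_lintegral _
        _ ≤ ∫⁻ t in Ioo 0 ts, (ENNReal.ofReal (M₂ / (2 * T₀)) + ENNReal.ofReal (2 * T₀) * eEnergy (g t)) :=
            setLIntegral_mono' measurableSet_Ioo fun t ht =>
              hslice t ⟨ht.1.le, ht.2.le.trans hts.2⟩
        _ = ENNReal.ofReal (M₂ / (2 * T₀)) * volume (Ioo (0 : ℝ) ts) +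
              ENNReal.ofReal (2 * T₀) * ∫⁻ t in Ioo 0 ts, eEnergy (g t) := by
            rw [lintegral_add_left' aemeasurable_const, setLIntegral_const,
              lintegral_const_mul' _ _ ENNReal.ofReal_ne_top]
        _ ≤ ENNReal.ofReal (M₂ / (2 * T₀)) * ENNReal.ofReal ts + ENNReal.ofReal (2 * T₀) * A := by
            rw [hvol]
            gcongr
            exact lintegral_mono_set (Ioo_subset_Icc_self.trans (Icc_subset_Icc le_rfl hts.2))
        _ ≤ ENNReal.ofReal (M₂ / 2) + ENNReal.ofReal (2 * T₀) * A := by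
            gcongr
            rw [← ENNReal.ofReal_mul (by positivity)]
            refine ENNReal.ofReal_le_ofReal ?_
            have : M₂ / (2 * T₀) * ts ≤ M₂ / (2 * T₀) * T₀ :=
              mul_le_mul_of_nonneg_left hts.2 (by positivity)
            calc M₂ / (2 * T₀) * ts ≤ M₂ / (2 * T₀) * T₀ := this
              _ = M₂ / 2 := by field_simp
  -- conclude
  intro t ht
  have hw2 : Integrable (fun x => ‖w t x‖ ^ 2) volume := by
    obtain ⟨K₀', hK₀'0, hK₀'⟩ := hdec.exists_uniform_slice_bound hsm hT₀ 0 4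
    refine integrable_of_le_decay₃ (C := K₀' * K₀') (r := 4)
      (((hsm.contDiff_slice ht).continuous.norm).pow 2) (by norm_num) fun x => ?_
    have hb : ‖w t x‖ ≤ K₀' * (1 + ‖x‖) ^ (-((4 : ℕ) : ℝ)) :=
      le_mul_rpow_neg_of_pow_mul_le (by simpa [norm_iteratedFDeriv_zero] using hK₀' t ht x)
    rw [norm_pow, norm_norm, sq]
    have hb' : ‖w t x‖ ≤ K₀' * (1 + ‖x‖) ^ (-(4 : ℝ)) := by simpa using hb
    exact mul_le_decay₃ (by norm_num) x (norm_nonneg _) (norm_nonneg _) hb' hb' hK₀'0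
  have hEt : ∫⁻ x, ‖w t x‖ₑ ^ 2 = ENNReal.ofReal (E t) := (ofReal_integral_norm_sq_eq_lintegral hw2).symm
  rw [hEt]
  by_cases hA : A = ⊤
  · rw [hA, ENNReal.mul_top (by simp [hT₀])]; exact le_top
  have hfin : ENNReal.ofReal (M₂ / 2) + ENNReal.ofReal (2 * T₀) * A ≠ ⊤ :=
    ENNReal.add_ne_top.2 ⟨ENNReal.ofReal_ne_top, ENNReal.mul_ne_top ENNReal.ofReal_ne_top hA⟩
  have hreal := (ENNReal.ofReal_le_iff_le_toReal hfin).1 hkey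
  rw [ENNReal.toReal_add ENNReal.ofReal_ne_top (ENNReal.mul_ne_top ENNReal.ofReal_ne_top hA),
    ENNReal.toReal_ofReal (by positivity), ENNReal.toReal_mul,
    ENNReal.toReal_ofReal (by positivity)] at hreal
  have hM4 : M₂ ≤ 4 * T₀ * A.toReal := by linarith
  calc ENNReal.ofReal (E t) ≤ ENNReal.ofReal M₂ := ENNReal.ofReal_le_ofReal (hEle t ht)
    _ ≤ ENNReal.ofReal (4 * T₀ * A.toReal) := ENNReal.ofReal_le_ofReal hM4
    _ = ENNReal.ofReal (4 * T₀) * A := by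
        rw [ENNReal.ofReal_mul (by positivity), ENNReal.ofReal_toReal hA]

end EnstrophyToL3

end Summit.NavierStokesRegularity.NavierStokesRegularity.Theorems
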